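import Mathlib
import Summits.NavierStokesRegularity.NavierStokesRegularity.Theorems.EulerZoomLiouvillePowerGaugeEulerLiouvilleCondenserComplexChart

/-!
# THE `ℂ`-CHART OF A COORDINATE PLANE: integrals over chart SETS (plate t47-P tools, nsreg-p2 g35 ROUND-45 §6)

Width piece for crux `EulerZoomLiouville.PowerGaugeEulerLiouville` (stmt-NavierStokesRegularity-19832), by name under
LEAD 19832 (ns-typeII-p2 g13); seat ns-sfl-p1 g6, `--supports stmt-NavierStokesRegularity-19832 --as helper`.
The set versions of t47-X's DISC ≤ SLICE (`Condenser.setIntegral_cdisc_le_integral_plane`), needed by the packing plate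
t47-P (a finite union of disjoint discs in one quiet plane) — chart `Φ_y z = y + z.re • e₀ + z.im • e₁`:

* `setIntegral_cchart_le_integral_plane` — for continuous `G ≥ 0`, measurable `U ⊆ ℂ` with `Φ_y(U) ⊆ B(0,R')`:
  `∫_U G(Φ_y z) dz ≤ ∫ a, 𝟙_{B(0,R')} G (plane (y 2) a)`;
* `setIntegral_cchart_sq_inner_le`, `setIntegral_cchart_sq_norm_fderiv_inner_le` — for compact such `U` and
  `ψ = ⟪V ∘ Φ_y, u⟫`, `‖u‖ ≤ 1`: `∫_U ψ² ≤` the truncated slice budget of `‖V‖²`, `∫_U ‖Dψ‖² ≤` that of `‖DV‖²`.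

HONEST FRAMING: real analysis in `ℝ³`; nothing here proves the crux E (19832 OPEN), any door Target, or any Navier–Stokes
statement; no summit statement is touched. [folklore]
-/

noncomputable section

open Set Filter Topology Metric Function MeasureTheory Real Complex
open scoped RealInnerProductSpace

set_option linter.dupNamespace false

namespace Summit.NavierStokesRegularity.NavierStokesRegularity.Theorems.PowerGaugeEulerLiouville.Condenser

/-- **CHART SET ≤ SLICE.**  For continuous `G ≥ 0` on `ℝ³` and a measurable `U ⊆ ℂ` whose chart image lies in
`B(0,R')`: `∫_U G(Φ_y z) dz ≤ ∫ a, 𝟙_{B(0,R')} G (plane (y 2) a)` (the disc version is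
`setIntegral_cdisc_le_integral_plane`). [folklore] -/
theorem setIntegral_cchart_le_integral_plane {G : EuclideanSpace ℝ (Fin 3) → ℝ} (hGc : Continuous G)
    (hG0 : ∀ x, 0 ≤ G x) {y : EuclideanSpace ℝ (Fin 3)} {R' : ℝ} {U : Set ℂ} (hUm : MeasurableSet U)
    (hfit : ∀ z ∈ U, ‖y + z.re • EuclideanSpace.basisFun (Fin 3) ℝ 0 + z.im • EuclideanSpace.basisFun (Fin 3) ℝ 1‖ < R') :
    ∫ z in U,
        G (y + z.re • EuclideanSpace.basisFun (Fin 3) ℝ 0 + z.im • EuclideanSpace.basisFun (Fin 3) ℝ 1) ≤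
      ∫ a, (ball (0 : EuclideanSpace ℝ (Fin 3)) R').indicator G (plane (y 2) a) := by
  set s : ℝ := y 2 with hs
  set c : EuclideanSpace ℝ (Fin 2) := WithLp.toLp 2 ![y 0, y 1] with hc
  set Φ : ℂ → EuclideanSpace ℝ (Fin 2) := fun z =>
    c + (WithLp.toLp 2 ((MeasurableEquiv.finTwoArrow (α := ℝ)).symm (z.re, z.im)) : EuclideanSpace ℝ (Fin 2))
    with hΦ
  have hΦmp : MeasurePreserving Φ volume volume := measurePreserving_cplaneChart c
  set h : EuclideanSpace ℝ (Fin 2) → ℝ := fun a =>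
    (ball (0 : EuclideanSpace ℝ (Fin 3)) R').indicator G (plane s a) with hh
  have hplane_c : Continuous (plane s) := by
    refine (PiLp.continuous_toLp 2 _).comp ?_
    refine continuous_pi fun i => ?_
    fin_cases i
    · exact PiLp.continuous_apply 2 _ 0
    · exact PiLp.continuous_apply 2 _ 1
    · exact continuous_const
  have hnorm_le : ∀ a : EuclideanSpace ℝ (Fin 2), ‖a‖ ≤ ‖plane s a‖ := by
    intro a
    have h2 : ‖a‖ ^ 2 ≤ ‖plane s a‖ ^ 2 := by
      rw [EuclideanSpace.norm_sq_eq, EuclideanSpace.norm_sq_eq, Fin.sum_univ_two, Fin.sum_univ_three]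
      simp [plane]
      nlinarith [sq_nonneg s]
    exact le_of_pow_le_pow_left₀ two_ne_zero (norm_nonneg _) h2
  set S' : Set (EuclideanSpace ℝ (Fin 2)) := plane s ⁻¹' ball (0 : EuclideanSpace ℝ (Fin 3)) R' with hS'
  have hS'm : MeasurableSet S' := measurableSet_ball.preimage hplane_c.measurable
  have hS'sub : S' ⊆ closedBall (0 : EuclideanSpace ℝ (Fin 2)) R' := by
    intro a ha
    rw [mem_closedBall, dist_zero_right]
    have : ‖plane s a‖ < R' := by simpa [hS'] using ha
    exact (hnorm_le a).trans this.le
  have hh_eq : h = S'.indicator (G ∘ plane s) := by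
    funext a
    simp only [hh, hS']
    exact (Set.indicator_comp_right (plane s) (s := ball (0 : EuclideanSpace ℝ (Fin 3)) R') (g := G)).symm
  have hh_int : Integrable h := by
    rw [hh_eq, integrable_indicator_iff hS'm]
    exact ((hGc.comp hplane_c).continuousOn.integrableOn_compact (isCompact_closedBall 0 R')).mono_set hS'sub
  have hh0 : ∀ a, 0 ≤ h a := fun a => Set.indicator_nonneg (fun x _ => hG0 x) _
  -- on `U`, the chart integrand is `h ∘ Φ`
  have hpt : ∀ z ∈ U,
      G (y + z.re • EuclideanSpace.basisFun (Fin 3) ℝ 0 + z.im • EuclideanSpace.basisFun (Fin 3) ℝ 1) = h (Φ z) := by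
    intro z hz
    have heq := cchart_eq_plane y z
    simp only [hh, hΦ, hs, hc]
    rw [← heq, Set.indicator_of_mem]
    rw [mem_ball, dist_zero_right]
    exact hfit z hz
  -- the chart as a measurable equivalence, and the comparison
  set Φe : ℂ ≃ᵐ EuclideanSpace ℝ (Fin 2) :=
    (Complex.measurableEquivRealProd.trans
      ((MeasurableEquiv.finTwoArrow (α := ℝ)).symm.trans (MeasurableEquiv.toLp 2 (Fin 2 → ℝ)))).trans
      (MeasurableEquiv.addLeft c) with hΦe
  have hΦe_coe : ⇑Φe = Φ := by
    funext z
    simp [hΦe, hΦ, MeasurableEquiv.coe_addLeft, Complex.measurableEquivRealProd_apply]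
  have hΦemp : MeasurePreserving Φe volume volume := by
    rw [hΦe_coe]; exact hΦmp
  have hcomp : ∫ z, h (Φe z) = ∫ a, h a := hΦemp.integral_comp' h
  have hint_comp : Integrable (fun z => h (Φe z)) :=
    (hΦemp.integrable_comp_emb Φe.measurableEmbedding).2 hh_int
  calc ∫ z in U,
        G (y + z.re • EuclideanSpace.basisFun (Fin 3) ℝ 0 + z.im • EuclideanSpace.basisFun (Fin 3) ℝ 1)
      = ∫ z in U, h (Φe z) :=
        setIntegral_congr_fun hUm fun z hz => by rw [hpt z hz, hΦe_coe]
    _ ≤ ∫ z, h (Φe z) := setIntegral_le_integral hint_comp (Filter.Eventually.of_forall fun z => hh0 _)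
    _ = ∫ a, h a := hcomp

/-- **Amplitude budget on a chart set.**  For `V ∈ C¹(ℝ³,ℝ³)`, `‖u‖ ≤ 1`, compact `U ⊆ ℂ` with `Φ_y(U) ⊆ B(0,R')`:
`∫_U ⟪V(Φ_y z), u⟫² dz ≤ ∫ a, 𝟙_{B(0,R')} ‖V‖² (plane (y 2) a)`. [folklore] -/
theorem setIntegral_cchart_sq_inner_le {V : EuclideanSpace ℝ (Fin 3) → EuclideanSpace ℝ (Fin 3)} (hV : ContDiff ℝ 1 V)
    {u : EuclideanSpace ℝ (Fin 3)} (hu : ‖u‖ ≤ 1) {y : EuclideanSpace ℝ (Fin 3)} {R' : ℝ} {U : Set ℂ}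
    (hUc : IsCompact U)
    (hfit : ∀ z ∈ U, ‖y + z.re • EuclideanSpace.basisFun (Fin 3) ℝ 0 + z.im • EuclideanSpace.basisFun (Fin 3) ℝ 1‖ < R') :
    ∫ z in U,
        ⟪V (y + z.re • EuclideanSpace.basisFun (Fin 3) ℝ 0 + z.im • EuclideanSpace.basisFun (Fin 3) ℝ 1), u⟫ ^ 2 ≤
      ∫ a, (ball (0 : EuclideanSpace ℝ (Fin 3)) R').indicator (fun x => ‖V x‖ ^ 2) (plane (y 2) a) := by
  have hVc : Continuous V := hV.continuous
  have hΦc := (contDiff_cchart y (n := 1)).continuous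
  refine le_trans ?_ (setIntegral_cchart_le_integral_plane (G := fun x => ‖V x‖ ^ 2) (hVc.norm.pow 2)
    (fun x => sq_nonneg _) hUc.isClosed.measurableSet hfit)
  refine setIntegral_mono_on ?_ ?_ hUc.isClosed.measurableSet fun z _ => sq_inner_le_norm_sq _ hu
  · exact (((hVc.comp hΦc).inner continuous_const).pow 2).continuousOn.integrableOn_compact hUc
  · exact ((hVc.comp hΦc).norm.pow 2).continuousOn.integrableOn_compact hUc

/-- **Energy budget on a chart set.**  For `V ∈ C¹(ℝ³,ℝ³)`, `‖u‖ ≤ 1`, compact `U ⊆ ℂ` with `Φ_y(U) ⊆ B(0,R')`,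
`ψ z = ⟪V(Φ_y z), u⟫`: `∫_U ‖Dψ‖² dz ≤ ∫ a, 𝟙_{B(0,R')} ‖DV‖² (plane (y 2) a)`. [folklore] -/
theorem setIntegral_cchart_sq_norm_fderiv_inner_le {V : EuclideanSpace ℝ (Fin 3) → EuclideanSpace ℝ (Fin 3)}
    (hV : ContDiff ℝ 1 V) {u : EuclideanSpace ℝ (Fin 3)} (hu : ‖u‖ ≤ 1) {y : EuclideanSpace ℝ (Fin 3)} {R' : ℝ}
    {U : Set ℂ} (hUc : IsCompact U)
    (hfit : ∀ z ∈ U, ‖y + z.re • EuclideanSpace.basisFun (Fin 3) ℝ 0 + z.im • EuclideanSpace.basisFun (Fin 3) ℝ 1‖ < R') :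
    ∫ z in U, ‖fderiv ℝ (fun z : ℂ =>
        ⟪V (y + z.re • EuclideanSpace.basisFun (Fin 3) ℝ 0 + z.im • EuclideanSpace.basisFun (Fin 3) ℝ 1), u⟫) z‖ ^ 2 ≤
      ∫ a, (ball (0 : EuclideanSpace ℝ (Fin 3)) R').indicator (fun x => ‖fderiv ℝ V x‖ ^ 2) (plane (y 2) a) := by
  have hVd : Differentiable ℝ V := hV.differentiable one_ne_zero
  have hDVc : Continuous (fderiv ℝ V) := hV.continuous_fderiv one_ne_zero
  have hΦc := (contDiff_cchart y (n := 1)).continuous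
  have hψ : ContDiff ℝ 1 (fun z : ℂ =>
      ⟪V (y + z.re • EuclideanSpace.basisFun (Fin 3) ℝ 0 + z.im • EuclideanSpace.basisFun (Fin 3) ℝ 1), u⟫) :=
    contDiff_comp_cchart (f := fun x => ⟪V x, u⟫) (hV.inner ℝ contDiff_const) y
  refine le_trans ?_ (setIntegral_cchart_le_integral_plane (G := fun x => ‖fderiv ℝ V x‖ ^ 2) (hDVc.norm.pow 2)
    (fun x => sq_nonneg _) hUc.isClosed.measurableSet hfit)
  refine setIntegral_mono_on ?_ ?_ hUc.isClosed.measurableSet fun z _ =>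
    pow_le_pow_left₀ (norm_nonneg _) (norm_fderiv_inner_comp_cchart_le hVd hu y z) 2
  · exact ((hψ.continuous_fderiv one_ne_zero).norm.pow 2).continuousOn.integrableOn_compact hUc
  · exact ((hDVc.comp hΦc).norm.pow 2).continuousOn.integrableOn_compact hUc

end Summit.NavierStokesRegularity.NavierStokesRegularity.Theorems.PowerGaugeEulerLiouville.Condenser

end
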